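import Summits.AtomisticToContinuum.HydrodynamicLimit.Theorems.MourreKoopmanChargesStressStrongMixingStaticClusteringMixing
import Summits.AtomisticToContinuum.HydrodynamicLimit.Theorems.MourreKoopmanChargesStressStrongMixingTwoTimeClustering
import Summits.AtomisticToContinuum.HydrodynamicLimit.Theorems.MourreKoopmanChargesStressStrongMixingStressFramework
import HarnessLib

/-!
# `OneBodyCompleteness` · line `registered`, stub `stub_densityClustering`: CLOSED
# (spatial clustering of the density of the low-activity hard-sphere gas)

Support file for the crux item stmt-AtomisticToContinuum-9583 (`OneBodyCompleteness`, route
`MourreKoopmanCharges` of `AtomisticToContinuum/HydrodynamicLimit`), line `registered`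
(`Cruxes/OneBodyCompleteness/Lines/birth.lean`, skeleton v6), closing the registered stub
`stub_densityClustering` VERBATIM:

  `∃ z₃ > 0, ∀ z β, 0 < z < z₃ → 0 < β → ∀ G, IsHardSphereGibbs 1 z β 0 G → IsTranslationInvariant G →`
  `Integrable (x ↦ Cov_G(N_C, N_C ∘ τ_x))`,

`N_C = cellCharge 0` the number of particles with position in the unit cell `C = [0,1)³`, `τ_x` the
spatial shift: the density–density truncated correlation of every translation-invariant DLR state of
unit hard spheres at activity `z < z₃ := 1/32` is integrable over `ℝ³` (Ruelle 1969 §4.4: exponential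
clustering of the low-activity gas; here in the DLR form of Michelen–Perkins 2021 Thm 25 / §5).

## Proof

* `N_C` is the particle count of the window `C × ℝ³` (`cellCharge_zero_eq_toNat_count`); it is LOCAL over
  the ball `B(0, 2) ⊇ C` (`count_restrict_of_subset`, `fst_preimage_unitCell_subset_window`), and on
  hard-core configurations `N_C ≤ 8` (the tree's packing bound `count_unitCube_le_of_isHardCore`), so
  `N_C = N_C ∧ 8` almost surely under `G` (`IsHardSphereGibbs.ae_isHardCore`), a bounded local observable.
* `N_C ∘ τ_x` counts the particles `p` with `p₁ + x ∈ C` (`cellCharge_zero_spatialShift`); for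
  `R + 2 ≤ ‖x‖` these lie outside `B(0, R) × ℝ³` (`shiftedCell_subset_compl`), so `N_C ∘ τ_x` is a
  cylinder observable of the complement of `B(0, R)`: it does not see particles thrown into `B(0, R)`
  (`count_superposeIn_of_subset`).
* The sibling crux's exponential `φ`-mixing bound `abs_cov_le_of_isHardSphereGibbs`
  (`…StressStrongMixingStaticClusteringMixing`, from the tree's uniform boundary-condition pinning
  `abs_hsLocalSpec_toReal_sub_le` and the DLR equations) with `k = 2`, `R = d + 4`, `C = 8`,
  `g = N_C ∘ τ_x ∈ L²(G)` (`memLp_generators_of_isHardSphereGibbs`, shift invariance) gives, for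
  `d + 6 ≤ ‖x‖` and `z ≤ 1/32` (so `ν(B(0,2) × ℝ³) ≤ 64 z ≤ 2`, `2κ = 16 z ≤ 1/2`),
  `|Cov_G(N_C, N_C ∘ τ_x)| ≤ 64 e² 2^{-d} · E_G[N_C]` (`abs_cov_cellCharge_zero_spatialShift_le`).
* With `d = ⌊‖x‖⌋ - 6` this is `≤ 64 e² 2⁷ E_G[N_C] · e^{-(log 2)‖x‖}` off the ball of radius `6`
  (`half_pow_le_two_pow_seven_mul_exp`), an integrable majorant on `ℝ³` (`integrable_exp_neg_mul_norm_V3`,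
  polar coordinates), and the sibling reduction `integrable_cov_comp_spatialShift_of_decay`
  (measurability in `x`, Cauchy–Schwarz on the ball) concludes.

References: D. Ruelle, *Statistical Mechanics: Rigorous Results* (1969), §4.2 Thm 4.2.3, §4.4;
M. Michelen, W. Perkins, *Potential-weighted connective constants and uniqueness of Gibbs measures*,
arXiv:2109.01094, Thm 3, Thm 25 and §5; H. Spohn, *Large Scale Dynamics of Interacting Particles* (1991),
Part I §7.1 (7.6)–(7.7), Condition 2.1.
-/

noncomputable section

namespace Summit.AtomisticToContinuum.HydrodynamicLimit.Theorems.MourreKoopmanChargesOneBodyCompleteness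

open MeasureTheory ProbabilityTheory Filter Topology
open scoped ENNReal
open Literature.MathematicalPhysics.KineticTheory Literature.Analysis.FluidPDE
open Literature.Analysis.FunctionSpaces (PointConfig maxwellianBeta)
open Literature.MathematicalPhysics.StatisticalMechanics (isProbabilityMeasure_withDensity_maxwellianBeta
  smul_prod_window volume_ball_two_le count_unitCube_le_of_isHardCore torusUnitCube_subset_ball)
open Literature.MathematicalPhysics.StatisticalMechanics.HardSphere (window mem_window)
open Summit.AtomisticToContinuum.HydrodynamicLimit.Theorems.MourreKoopmanChargesStressStrongMixing
  (abs_cov_le_of_isHardSphereGibbs integrable_cov_comp_spatialShift_of_decay memLp_generators_of_isHardSphereGibbs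
    cellCharge_zero_eq_ncard)

namespace DensityClustering

/-! ### The number charge of the unit cell as a particle count; locality -/

/-- **The number charge of the unit cell is the particle count of the window `[0,1)³ × ℝ³`**
(`ℕ∞`-count truncated to `ℕ`, cast to `ℝ`; both sides are `0` for infinitely many particles over the
cell). [folklore] -/
theorem cellCharge_zero_eq_toNat_count (ω : MarkedConfig) :
    cellCharge 0 ω = (((ω.count (Prod.fst ⁻¹' unitCell)).toNat : ℕ) : ℝ) := by
  rw [cellCharge_zero_eq_ncard, PointConfig.count, Set.ncard_def, PointConfig.coe_eq_carrier]

/-- The number charge of the unit cell is non-negative. [folklore] -/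
theorem cellCharge_zero_nonneg (ω : MarkedConfig) : 0 ≤ cellCharge 0 ω := by
  rw [cellCharge_zero_eq_ncard]; exact Nat.cast_nonneg _

/-- **The shifted number charge**: `(N_C ∘ τ_x)(ω)` is the number of particles `p ∈ ω` with
`p₁ + x ∈ [0,1)³` (`τ_x` translates every particle by `(x, 0)`). [folklore] -/
theorem cellCharge_zero_spatialShift (x : V3) (ω : MarkedConfig) :
    cellCharge 0 (spatialShift x ω) =
      (((ω.count ((fun p : V3 × V3 => p + (x, (0 : V3))) ⁻¹' (Prod.fst ⁻¹' unitCell))).toNat : ℕ) : ℝ) := by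
  rw [cellCharge_zero_eq_toNat_count, spatialShift_apply, PointConfig.count_translate]

/-- Restricting a configuration to a window containing `t` does not change the count of `t`. [folklore] -/
theorem count_restrict_of_subset {s t : Set (V3 × V3)} (h : t ⊆ s) (ω : MarkedConfig) :
    (PointConfig.restrict s ω).count t = ω.count t := by
  rw [PointConfig.count_restrict, Set.inter_eq_right.2 h]

/-- **Counts outside `Λ × ℝ³` do not see the particles thrown into `Λ`**: for `t ⊆ Λᶜ × ℝ³`,
`N_t(superposeIn Λ y Y) = N_t(Y)`. [folklore] -/
theorem count_superposeIn_of_subset {Λ : Set V3} {t : Set (V3 × V3)} (h : t ⊆ Prod.fst ⁻¹' Λᶜ)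
    {n : ℕ} (y : Fin n → V3 × V3) (Y : MarkedConfig) :
    (superposeIn Λ y Y).count t = Y.count t := by
  simp only [PointConfig.count]
  congr 1
  ext p
  change p ∈ ((Set.range y ∩ Prod.fst ⁻¹' Λ) ∪ ((Y : Set (V3 × V3)) ∩ Prod.fst ⁻¹' Λᶜ)) ∩ t ↔
    p ∈ Y.carrier ∩ t
  constructor
  · rintro ⟨hp | hp, hpt⟩
    · exact absurd hp.2 (h hpt)
    · exact ⟨hp.1, hpt⟩
  · rintro ⟨hpY, hpt⟩
    exact ⟨Or.inr ⟨hpY, h hpt⟩, hpt⟩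

/-- The window of the unit cell lies in the window of the ball `B(0, 2)` (`‖q‖ ≤ √3 < 2` on `[0,1)³`).
[folklore] -/
theorem fst_preimage_unitCell_subset_window :
    (Prod.fst ⁻¹' unitCell : Set (V3 × V3)) ⊆ window (Metric.ball (0 : V3) 2) :=
  fun _ hp => mem_window.2 (torusUnitCube_subset_ball hp)

/-- **The shifted cell is far away**: if `R + 2 ≤ ‖x‖`, a particle `p` with `p₁ + x ∈ [0,1)³` has
`‖p₁‖ > ‖x‖ - 2 ≥ R`, i.e. lies outside `B(0, R) × ℝ³`. [folklore] -/
theorem shiftedCell_subset_compl {R : ℝ} {x : V3} (hx : R + 2 ≤ ‖x‖) :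
    ((fun p : V3 × V3 => p + (x, (0 : V3))) ⁻¹' (Prod.fst ⁻¹' unitCell) : Set (V3 × V3)) ⊆
      Prod.fst ⁻¹' (Metric.ball (0 : V3) R)ᶜ := by
  intro p hp
  have hp' : p.1 + x ∈ Metric.ball (0 : V3) 2 := torusUnitCube_subset_ball hp
  rw [Metric.mem_ball, dist_zero_right] at hp'
  simp only [Set.mem_preimage, Set.mem_compl_iff, Metric.mem_ball, dist_zero_right, not_lt]
  have h1 : ‖x‖ ≤ ‖p.1 + x‖ + ‖p.1‖ := by
    have := norm_add_le (p.1 + x) (-p.1)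
    rwa [add_neg_cancel_comm, norm_neg] at this
  linarith

/-- **Packing bound for the number charge**: a unit-diameter hard-sphere configuration has at most `8`
particles with position in the unit cell (the tree's `count_unitCube_le_of_isHardCore`). [folklore] -/
theorem cellCharge_zero_le_eight {ω : MarkedConfig}
    (hω : Literature.MathematicalPhysics.StatisticalMechanics.HardSphere.IsHardCore 1 ω) : cellCharge 0 ω ≤ 8 := by
  rw [cellCharge_zero_eq_toNat_count]
  have h : ω.count (Prod.fst ⁻¹' unitCell) ≤ 8 := count_unitCube_le_of_isHardCore hω
  have h' : (ω.count (Prod.fst ⁻¹' unitCell)).toNat ≤ 8 := by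
    have := ENat.toNat_le_toNat h (by decide)
    simpa using this
  exact_mod_cast h'

/-! ### The exponentially decaying majorant -/

/-- **`e^{-b‖x‖}` is integrable on `ℝ³`** for `b > 0` (polar coordinates: `r² e^{-br}` is integrable on
`(0, ∞)`). [folklore] -/
theorem integrable_exp_neg_mul_norm_V3 {b : ℝ} (hb : 0 < b) :
    Integrable (fun x : V3 => Real.exp (-b * ‖x‖)) volume := by
  have h := (integrable_fun_norm_addHaar (volume : Measure V3) (f := fun r : ℝ => Real.exp (-b * r))).2
  refine h ?_
  rw [finrank_euclideanSpace_fin, show (3 : ℕ) - 1 = 2 from rfl]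
  have h2 := integrableOn_rpow_mul_exp_neg_mul_rpow (s := 2) (p := 1) (by norm_num) le_rfl hb
  refine h2.congr_fun (fun r _ => ?_) measurableSet_Ioi
  simp only [smul_eq_mul, Real.rpow_one, Real.rpow_two]

/-- The geometric factor against the exponential majorant: if `t ≤ d + 7` then
`2^{-d} ≤ 2⁷ e^{-(log 2) t}`. [folklore] -/
theorem half_pow_le_two_pow_seven_mul_exp {t : ℝ} {d : ℕ} (hd : t ≤ d + 7) :
    (1 / 2 : ℝ) ^ d ≤ 2 ^ 7 * Real.exp (-(Real.log 2) * t) := by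
  have hlog : 0 < Real.log 2 := Real.log_pos one_lt_two
  have e1 : (1 / 2 : ℝ) ^ d = Real.exp (-(Real.log 2) * (d : ℝ)) := by
    rw [← Real.exp_log (by positivity : (0 : ℝ) < (1 / 2) ^ d), Real.log_pow, one_div, Real.log_inv]
    ring_nf
  have e2 : (2 : ℝ) ^ 7 * Real.exp (-(Real.log 2) * t) = Real.exp (-(Real.log 2) * (t - 7)) := by
    rw [show -(Real.log 2) * (t - 7) = (7 : ℕ) * Real.log 2 + -(Real.log 2) * t by push_cast; ring, Real.exp_add,
      ← Real.log_pow, Real.exp_log (by positivity)]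
  rw [e1, e2]
  exact Real.exp_le_exp.2 (by nlinarith)

/-! ### The decay estimate of the density–density truncated correlation -/

/-- **Exponential clustering of the density of the low-activity hard-core gas.**  Let `G` be a
translation-invariant DLR Gibbs state of unit hard spheres at activity `0 < z ≤ 1/32`, inverse temperature
`β > 0`, zero drift.  If `d + 6 ≤ ‖x‖` (`d ∈ ℕ`), then
`|Cov_G(N_C, N_C ∘ τ_x)| ≤ 64 e² 2^{-d} · E_G[N_C]`: the sibling's `φ`-mixing bound
`abs_cov_le_of_isHardSphereGibbs` for the bounded local observable `N_C ∧ 8` (`= N_C` a.s., local over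
`B(0, 2)`) and the outside observable `N_C ∘ τ_x` (cylinder over the complement of `B(0, d + 4)`), with the
constants `ν(B(0,2) × ℝ³) ≤ 64 z ≤ 2`, `2κ = 16 z ≤ 1/2` and `‖N_C ∘ τ_x‖_{L¹(G)} = E_G[N_C]` (shift
invariance). [cite: MichelenPerkins2021, Thm 25 and §5] -/
theorem abs_cov_cellCharge_zero_spatialShift_le {z β : ℝ} (hz : 0 < z) (hz1 : z ≤ 1 / 32) (hβ : 0 < β)
    {G : Measure MarkedConfig} (hG : IsHardSphereGibbs 1 z β (0 : V3) G) (hti : IsTranslationInvariant G)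
    {x : V3} {d : ℕ} (hx : (d : ℝ) + 6 ≤ ‖x‖) :
    |cov[cellCharge 0, cellCharge 0 ∘ spatialShift x; G]| ≤
      64 * Real.exp 2 * (1 / 2) ^ d * ∫ ω, cellCharge 0 ω ∂G := by
  haveI := hG.1
  have hzσ : 16 * (z * (1 : ℝ) ^ 3) < 1 := by nlinarith
  -- the truncated number charge, a bounded local observable over `B(0, 2)`, a.s. equal to `N_C`
  set f : MarkedConfig → ℝ := fun ω => min (cellCharge 0 ω) 8 with hf
  have hfm : Measurable f := (measurable_cellCharge 0).min measurable_const
  have hfC : ∀ ω, |f ω| ≤ 8 := fun ω => by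
    rw [abs_le]
    exact ⟨by linarith [le_min (cellCharge_zero_nonneg ω) (by norm_num : (0 : ℝ) ≤ 8)], min_le_right _ _⟩
  have hfr : ∀ ω, f (PointConfig.restrict (window (Metric.ball (0 : V3) 2)) ω) = f ω := fun ω => by
    simp only [hf, cellCharge_zero_eq_toNat_count, count_restrict_of_subset fst_preimage_unitCell_subset_window]
  have hfae : cellCharge 0 =ᵐ[G] f := by
    filter_upwards [hG.ae_isHardCore] with ω hω
    exact (min_eq_left (cellCharge_zero_le_eight hω)).symm
  -- the shifted number charge, a square-integrable cylinder observable of the complement of `B(0, d + 4)`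
  set g : MarkedConfig → ℝ := cellCharge 0 ∘ spatialShift x with hg
  have hgm : Measurable g := (measurable_cellCharge 0).comp (spatialShift.measurable x)
  have hshift : MeasurePreserving (spatialShift x) G G := ⟨PointConfig.measurable_translate _, hti x⟩
  have hG' : IsHardSphereGibbs 1 z β⁻¹⁻¹ (0 : V3) G := by rwa [inv_inv]
  have h2 : MemLp (cellCharge 0) 2 G :=
    memLp_generators_of_isHardSphereGibbs 1 β⁻¹ z one_pos (inv_pos.2 hβ) hz G hG' (cellCharge 0)
      (Or.inl ⟨0, rfl⟩)
  have hg2 : MemLp g 2 G := h2.comp_measurePreserving hshift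
  have hR : (2 : ℝ) + (d + 2) * 1 ≤ (d : ℝ) + 4 := by linarith
  have hxR : ((d : ℝ) + 4) + 2 ≤ ‖x‖ := by linarith
  have hgcyl : ∀ (n : ℕ) (y : Fin n → V3 × V3) (Y : MarkedConfig),
      g (superposeIn (Metric.ball (0 : V3) ((d : ℝ) + 4)) y Y) = g Y := fun n y Y => by
    simp only [hg, Function.comp_apply, cellCharge_zero_spatialShift,
      count_superposeIn_of_subset (shiftedCell_subset_compl hxR)]
  -- the `φ`-mixing bound of the sibling crux
  have key := abs_cov_le_of_isHardSphereGibbs one_pos hz.le hzσ hβ hG hR hfm (by norm_num : (0 : ℝ) ≤ 8) hfC hfr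
    hgm hg2 hgcyl
  -- bookkeeping: `Cov(N_C, g) = Cov(f, g)`, `‖g‖₁ = E[N_C]`
  have hcov : cov[cellCharge 0, cellCharge 0 ∘ spatialShift x; G] = cov[f, g; G] :=
    covariance_congr_ae hfae EventuallyEq.rfl
  have hI : ∫ ω, |g ω| ∂G = ∫ ω, cellCharge 0 ω ∂G := by
    have e1 : ∫ ω, |g ω| ∂G = ∫ ω, |cellCharge 0 ω| ∂(G.map (spatialShift x)) := by
      rw [integral_map (spatialShift.measurable x).aemeasurable]
      · rfl
      · exact (measurable_cellCharge 0).norm.aestronglyMeasurable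
    rw [e1, hshift.map_eq]
    exact integral_congr_ae (ae_of_all _ fun ω => abs_of_nonneg (cellCharge_zero_nonneg ω))
  -- the constants: `ν(B(0,2) × ℝ³) ≤ 64 z ≤ 2`, `2κ = 16 z ≤ 1/2`
  haveI := isProbabilityMeasure_withDensity_maxwellianBeta hβ (0 : V3)
  set M : Measure V3 := (volume : Measure V3).withDensity fun v => ENNReal.ofReal (maxwellianBeta β (v - 0)) with hM
  set ν : Measure (V3 × V3) := (Real.toNNReal z) • ((volume : Measure V3).prod M) with hν
  have hνW : ν.real (window (Metric.ball (0 : V3) 2)) ≤ 2 := by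
    rw [measureReal_def, hν, smul_prod_window, measure_univ, mul_one]
    have h64 : ENNReal.ofReal z * volume (Metric.ball (0 : V3) 2) ≤ ENNReal.ofReal (z * 64) := by
      rw [ENNReal.ofReal_mul hz.le]; gcongr; exact volume_ball_two_le 0
    calc (ENNReal.ofReal z * volume (Metric.ball (0 : V3) 2)).toReal ≤ (ENNReal.ofReal (z * 64)).toReal :=
          ENNReal.toReal_mono ENNReal.ofReal_ne_top h64
      _ = z * 64 := ENNReal.toReal_ofReal (by positivity)
      _ ≤ 2 := by linarith
  have hνW0 : 0 ≤ ν.real (window (Metric.ball (0 : V3) 2)) := measureReal_nonneg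
  have hexp : Real.exp (ν.real (window (Metric.ball (0 : V3) 2))) ≤ Real.exp 2 := Real.exp_le_exp.2 hνW
  have hpow : (2 * (8 * (z * (1 : ℝ) ^ 3))) ^ d ≤ (1 / 2 : ℝ) ^ d :=
    pow_le_pow_left₀ (by positivity) (by linarith) d
  have hδ : 2 * ν.real (window (Metric.ball (0 : V3) 2)) * Real.exp (ν.real (window (Metric.ball (0 : V3) 2))) *
      (2 * (8 * (z * (1 : ℝ) ^ 3))) ^ d ≤ 4 * Real.exp 2 * (1 / 2 : ℝ) ^ d := by
    calc 2 * ν.real (window (Metric.ball (0 : V3) 2)) * Real.exp (ν.real (window (Metric.ball (0 : V3) 2))) *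
          (2 * (8 * (z * (1 : ℝ) ^ 3))) ^ d ≤ 2 * 2 * Real.exp 2 * (1 / 2 : ℝ) ^ d := by gcongr
      _ = 4 * Real.exp 2 * (1 / 2) ^ d := by ring
  -- conclusion
  have hI0 : 0 ≤ ∫ ω, cellCharge 0 ω ∂G := integral_nonneg cellCharge_zero_nonneg
  rw [hcov]
  rw [hI] at key
  refine key.trans ?_
  calc 2 * 8 * (2 * ν.real (window (Metric.ball (0 : V3) 2)) * Real.exp (ν.real (window (Metric.ball (0 : V3) 2))) *
        (2 * (8 * (z * (1 : ℝ) ^ 3))) ^ d) * ∫ ω, cellCharge 0 ω ∂G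
      ≤ 2 * 8 * (4 * Real.exp 2 * (1 / 2 : ℝ) ^ d) * ∫ ω, cellCharge 0 ω ∂G :=
        mul_le_mul_of_nonneg_right (mul_le_mul_of_nonneg_left hδ (by norm_num)) hI0
    _ = 64 * Real.exp 2 * (1 / 2) ^ d * ∫ ω, cellCharge 0 ω ∂G := by ring

end DensityClustering

open DensityClustering

/-- **Registered stub `stub_densityClustering` (CLOSED) — spatial clustering of the DENSITY of the
low-activity hard-core gas.**  Below the activity threshold `z₃ = 1/32`, for every inverse temperature
`β > 0` and every translation-invariant DLR Gibbs state `G` of unit hard spheres at activity `z < z₃` (zero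
drift), the density–density truncated correlation `x ↦ Cov_G(N_C, N_C ∘ τ_x)` of the unit-cell particle
number `N_C = n_0` is integrable on `ℝ³`: off the ball of radius `6` it is bounded by
`64 e² 2⁷ E_G[N_C] · e^{-(log 2)‖x‖}` (`abs_cov_cellCharge_zero_spatialShift_le` with `d = ⌊‖x‖⌋ - 6`
separating shells), an integrable majorant, and the reduction `integrable_cov_comp_spatialShift_of_decay`
(measurability in the shift, Cauchy–Schwarz on the ball) concludes.  Ruelle 1969 §4.4 (cluster property
of the low-activity correlation functions) in the DLR form of Michelen–Perkins 2021.
[cite: Ruelle1969, §4.4] -/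
theorem stub_densityClustering :
    ∃ z₃ : ℝ, 0 < z₃ ∧ ∀ z β : ℝ, 0 < z → z < z₃ → 0 < β →
      ∀ G : Measure MarkedConfig, IsHardSphereGibbs 1 z β (0 : V3) G → IsTranslationInvariant G →
        Integrable (fun x : V3 => cov[cellCharge 0, cellCharge 0 ∘ spatialShift x; G]) volume := by
  refine ⟨1 / 32, by norm_num, fun z β hz hz3 hβ G hG hti => ?_⟩
  haveI := hG.1
  have hshift : ∀ x : V3, MeasurePreserving (spatialShift x) G G := fun x =>
    ⟨PointConfig.measurable_translate _, hti x⟩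
  have hG' : IsHardSphereGibbs 1 z β⁻¹⁻¹ (0 : V3) G := by rwa [inv_inv]
  have h2 : MemLp (cellCharge 0) 2 G :=
    memLp_generators_of_isHardSphereGibbs 1 β⁻¹ z one_pos (inv_pos.2 hβ) hz G hG' (cellCharge 0) (Or.inl ⟨0, rfl⟩)
  set I : ℝ := ∫ ω, cellCharge 0 ω ∂G with hI
  have hI0 : 0 ≤ I := integral_nonneg cellCharge_zero_nonneg
  -- the integrable majorant `64 e² 2⁷ E[N_C] · e^{-(log 2)‖x‖}`
  have hmaj : Integrable (fun x : V3 => 64 * Real.exp 2 * 2 ^ 7 * I * Real.exp (-(Real.log 2) * ‖x‖)) volume :=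
    (integrable_exp_neg_mul_norm_V3 (Real.log_pos one_lt_two)).const_mul _
  refine integrable_cov_comp_spatialShift_of_decay hshift (measurable_cellCharge 0) (measurable_cellCharge 0) h2 h2
    hmaj (R := 6) fun x hx => ?_
  -- decay off the ball of radius `6`: `d = ⌊‖x‖⌋ - 6` separating shells
  obtain ⟨d, hd, hd'⟩ : ∃ d : ℕ, (d : ℝ) + 6 ≤ ‖x‖ ∧ ‖x‖ ≤ d + 7 := by
    have h6 : 6 ≤ ⌊‖x‖⌋₊ := Nat.le_floor (by exact_mod_cast hx)
    have hfl : ((⌊‖x‖⌋₊ : ℕ) : ℝ) ≤ ‖x‖ := Nat.floor_le (norm_nonneg x)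
    have hlt : ‖x‖ < ⌊‖x‖⌋₊ + 1 := Nat.lt_floor_add_one ‖x‖
    refine ⟨⌊‖x‖⌋₊ - 6, ?_, ?_⟩ <;> push_cast [Nat.cast_sub h6] <;> linarith
  refine (abs_cov_cellCharge_zero_spatialShift_le hz hz3.le hβ hG hti hd).trans ?_
  calc 64 * Real.exp 2 * (1 / 2) ^ d * I ≤ 64 * Real.exp 2 * (2 ^ 7 * Real.exp (-(Real.log 2) * ‖x‖)) * I :=
        mul_le_mul_of_nonneg_right (mul_le_mul_of_nonneg_left (half_pow_le_two_pow_seven_mul_exp hd')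
          (by positivity)) hI0
    _ = 64 * Real.exp 2 * 2 ^ 7 * I * Real.exp (-(Real.log 2) * ‖x‖) := by ring

end Summit.AtomisticToContinuum.HydrodynamicLimit.Theorems.MourreKoopmanChargesOneBodyCompleteness

end
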